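import Mathlib
import Summits.ValiantsHypothesis.ValiantsHypothesis.Theorems.ElementaryWordLengthWordLengthQPStubKappaTwoStructureAux
import Summits.ValiantsHypothesis.ValiantsHypothesis.Theorems.ElementaryWordLengthWordLengthQPStubKappaTwoStructureAuxB
import Summits.ValiantsHypothesis.ValiantsHypothesis.Theorems.ElementaryWordLengthWordLengthQPStubKappaTwoStructureAuxC
import Summits.ValiantsHypothesis.ValiantsHypothesis.Theorems.ElementaryWordLengthWordLengthQPStubKappaTwoStructureAuxD
import Summits.ValiantsHypothesis.ValiantsHypothesis.Theorems.ElementaryWordLengthWordLengthQPStubKappaTwoStructureAuxE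
import Summits.ValiantsHypothesis.ValiantsHypothesis.Theorems.ElementaryWordLengthWordLengthQPStubKappaTwoStructureAuxF
import Summits.ValiantsHypothesis.ValiantsHypothesis.Theorems.ElementaryWordLengthWordLengthQPStubKappaTwoStructureAuxG
import Summits.ValiantsHypothesis.ValiantsHypothesis.Theorems.ElementaryWordLengthWordLengthQPStubKappaTwoStructureAuxH
import Summits.ValiantsHypothesis.ValiantsHypothesis.Theorems.ElementaryWordLengthWordLengthQPStubKappaTwoStructureAuxI
import Summits.ValiantsHypothesis.ValiantsHypothesis.Theorems.ElementaryWordLengthWordLengthQPStubKappaTwoStructureAuxJ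
import Summits.ValiantsHypothesis.ValiantsHypothesis.Theorems.ElementaryWordLengthWordLengthQPStubKappaTwoStructureAuxK

/-!
# Crux `WordLengthQP` (stmt-ValiantsHypothesis-6623), line `positive-monoid-exits` —
stub `stub_kappaTwoStructure`: RUNG 2, the `κ = 2` STRUCTURE THEOREM for nonnegative targets.

**Theorem.** If `F ≠ 0` has nonnegative coefficients and no monomial of degree `≤ 2`, every real
affine elementary word of width `3` computing `E₀₂(F)` has at least THREE exits (letters that are
not (positive coefficient and adjacent)).

**Proof (assembled from parts A–K).**  Suppose at most two exits; WILD letters (exits with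
nonzero coefficient) are at most two, the others are TAME (positive adjacent, or the identity).
* At most one wild letter: isolate it, `S L S = P₀ʳᵉᵛ E₀₂(F) P₁ʳᵉᵛ ≥ E₀₂(F)` coefficientwise while
  `(S L S)₀₂` has total degree `≤ 1` (part B).
* Two wild letters `w = P₀ ℓ₁ Q ℓ₂ P₂`: `(Sℓ₁S)(SQS)(Sℓ₂S) = P₀ʳᵉᵛ E₀₂(F) P₂ʳᵉᵛ ≥ E₀₂(F) ≥ 0`
  (part B); the PLACEMENT lemma (part C) leaves only `ℓ₁` in row `1` and `ℓ₂` in column `1`,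
  i.e. the four families `(y₁|x₂)·Q·(x₁|y₂)`.
* Each family dies by the SKELETON / FIRST-ORDER method (parts D–K): the constant letters form a
  loop `W̄ = 1`, a rotation of the loop confines them to one block or one triangle, and then the
  first-order identity `∂_v W|₀ = Σ_k Ḡ_{<k} c_k e_{i_k j_k} Ḡ_{<k}⁻¹ = 0`, tested against a
  bilinear form positive on one letter type (`(P̄₂ Ḡ)₁₁ ≥ 1` is the key inequality of the
  `(y₁,x₁)` family — a closed form of a winding-number obstruction), kills that letter type,
  after which `F = 0` or `deg F ≤ 2`.
Total nonnegativity (Cauchy–Binet) is NOT needed; only coefficientwise/entrywise nonnegativity,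
`S`-conjugation, and `2 × 2` determinant bookkeeping in the skeleton.  The hypothesis `deg ≥ 3`
is used only in the placement lemma and in the `(x₂,x₁)` family (where `E₀₂(ab)` =
`x₂(-b)x₁(a)x₂(b)x₁(-a)` shows it is sharp); `F ≥ 0` only in parts B–C.
Falsification attempts (exact, this seat, all negative as the theorem predicts): no word with
`≤ 2` exits computes `E₀₂(F)` with `F ∈ t³ℚ[t] ∖ 0` among all words of length `≤ 8` over the
alphabet `E_ij(±c tᵏ)`, `c ∈ {1,2}`, `k ∈ {0,1}` (meet-in-the-middle over `1.9·10⁶` half-words);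
none in the `(y₁,x₁)` family up to length `10` (constants `{1,2}`, `β ∈ {1/2,1,2}`) or `8`
(constants `{1/2,1,2,3}`); and none of `45523` skeleton loops of length `≤ 10` admits even a
first-order cancellation of its `x₂`-letters (exact rational LP).
References: [FallatJohnson2011] Thm 1.1.1, 1.3.3 (background); [BenOrCleve1992] (elementary
words); Lusztig 1994 / Fomin–Zelevinsky 1999 (the positive monoid).
-/

set_option linter.dupNamespace false

noncomputable section

namespace Summit.ValiantsHypothesis.ValiantsHypothesis.Cruxes.WordLengthQP.PositiveMonoidExits

open MvPolynomial

/-- **Rung 2 — the `κ = 2` structure theorem for nonnegative targets** (stub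
`stub_kappaTwoStructure` of line `positive-monoid-exits`): if `F ≠ 0` has nonnegative
coefficients and no monomial of degree `≤ 2`, then every real word computing `E₀₂(F)` has at
least three exits.  See the module docstring for the proof.  The validity hypothesis `hw`
(`i ≠ j` for every letter) is used. [cite: BenOrCleve1992, Thm 1] -/
theorem stub_kappaTwoStructure {σ : Type} (F : MvPolynomial σ ℝ)
    (hpos : ∀ m, 0 ≤ F.coeff m) (hdeg : ∀ m ∈ F.support, 3 ≤ m.degree) (hF0 : F ≠ 0)
    (w : List (Fin 3 × Fin 3 × ℝ × Option σ)) (hw : ∀ l ∈ w, l.1 ≠ l.2.1)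
    (hF : (w.map (fun l => Matrix.transvection l.1 l.2.1
        (MvPolynomial.C l.2.2.1 * l.2.2.2.elim 1 MvPolynomial.X))).prod =
        Matrix.transvection (0 : Fin 3) 2 F) :
    3 ≤ (w.filter (fun l => !decide (0 < l.2.2.1 ∧
          (l.1.val + 1 = l.2.1.val ∨ l.2.1.val + 1 = l.1.val)))).length := by
  classical
  have hF' : (w.map (fun l => (Matrix.transvection (Prod.fst l) (Prod.fst (Prod.snd l)) (MvPolynomial.C (Prod.fst (Prod.snd (Prod.snd l))) * Option.elim (Prod.snd (Prod.snd (Prod.snd l))) 1 MvPolynomial.X) : Matrix (Fin 3) (Fin 3) (MvPolynomial σ ℝ)))).prod = Matrix.transvection (0 : Fin 3) 2 F := hF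
  by_contra hlt
  push Not at hlt
  -- a monomial of `F`: degree ≥ 3, positive coefficient
  obtain ⟨m₀, hm₀⟩ := MvPolynomial.ne_zero_iff.1 hF0
  have hms : m₀ ∈ F.support := MvPolynomial.mem_support_iff.2 hm₀
  have hdm : 3 ≤ m₀.degree := hdeg m₀ hms
  have hFm₀ : 0 < F.coeff m₀ := lt_of_le_of_ne (hpos m₀) (Ne.symm hm₀)
  -- at most two wild letters
  have hwild : (w.filter (fun l => decide (¬ (0 < Prod.fst (Prod.snd (Prod.snd l)) ∧ (Fin.val (Prod.fst l) + 1 = Fin.val (Prod.fst (Prod.snd l)) ∨ Fin.val (Prod.fst (Prod.snd l)) + 1 = Fin.val (Prod.fst l))) ∧ Prod.fst (Prod.snd (Prod.snd l)) ≠ 0))).length ≤ 2 :=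
    le_trans (k2_length_filter_mono _ _ (fun l h => k2_ex_of_wd l h) w) (by omega)
  rcases Nat.lt_or_ge (w.filter (fun l => decide (¬ (0 < Prod.fst (Prod.snd (Prod.snd l)) ∧ (Fin.val (Prod.fst l) + 1 = Fin.val (Prod.fst (Prod.snd l)) ∨ Fin.val (Prod.fst (Prod.snd l)) + 1 = Fin.val (Prod.fst l))) ∧ Prod.fst (Prod.snd (Prod.snd l)) ≠ 0))).length 2 with h1 | h2
  · exact k2_le_one_wild_absurd F hpos m₀ (by omega) hFm₀ w (by omega) hF'
  have heq : (w.filter (fun l => decide (¬ (0 < Prod.fst (Prod.snd (Prod.snd l)) ∧ (Fin.val (Prod.fst l) + 1 = Fin.val (Prod.fst (Prod.snd l)) ∨ Fin.val (Prod.fst (Prod.snd l)) + 1 = Fin.val (Prod.fst l))) ∧ Prod.fst (Prod.snd (Prod.snd l)) ≠ 0))).length = 2 := le_antisymm hwild h2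
  obtain ⟨p0, L1, q, L2, p2, rfl, -, -, hp0, hq, hp2⟩ := k2_split2 _ w heq
  have ht : ∀ l ∈ p0 ++ q ++ p2, ((0 < Prod.fst (Prod.snd (Prod.snd l)) ∧ (Fin.val (Prod.fst l) + 1 = Fin.val (Prod.fst (Prod.snd l)) ∨ Fin.val (Prod.fst (Prod.snd l)) + 1 = Fin.val (Prod.fst l))) ∨ Prod.fst (Prod.snd (Prod.snd l)) = 0) := by
    intro l hl
    simp only [List.mem_append] at hl
    rcases hl with (h | h) | h
    · exact k2_tame_cases l (hp0 l h)
    · exact k2_tame_cases l (hq l h)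
    · exact k2_tame_cases l (hp2 l h)
  have hq' : ∀ l ∈ q, ((0 < Prod.fst (Prod.snd (Prod.snd l)) ∧ (Fin.val (Prod.fst l) + 1 = Fin.val (Prod.fst (Prod.snd l)) ∨ Fin.val (Prod.fst (Prod.snd l)) + 1 = Fin.val (Prod.fst l))) ∨ Prod.fst (Prod.snd (Prod.snd l)) = 0) := fun l hl => ht l (by simp [hl])
  -- the conjugated identity `(Sℓ₁S)(SQS)(Sℓ₂S) = P₀ʳᵉᵛ E P₂ʳᵉᵛ`
  have hid := k2_two_wild_identity (Matrix.diagonal ![(1 : MvPolynomial σ ℝ), -1, 1]) k2_S_mul_S (p0.map (fun l => (Matrix.transvection (Prod.fst l) (Prod.fst (Prod.snd l)) (MvPolynomial.C (Prod.fst (Prod.snd (Prod.snd l))) * Option.elim (Prod.snd (Prod.snd (Prod.snd l))) 1 MvPolynomial.X) : Matrix (Fin 3) (Fin 3) (MvPolynomial σ ℝ))))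
    (q.map (fun l => (Matrix.transvection (Prod.fst l) (Prod.fst (Prod.snd l)) (MvPolynomial.C (Prod.fst (Prod.snd (Prod.snd l))) * Option.elim (Prod.snd (Prod.snd (Prod.snd l))) 1 MvPolynomial.X) : Matrix (Fin 3) (Fin 3) (MvPolynomial σ ℝ)))) (p2.map (fun l => (Matrix.transvection (Prod.fst l) (Prod.fst (Prod.snd l)) (MvPolynomial.C (Prod.fst (Prod.snd (Prod.snd l))) * Option.elim (Prod.snd (Prod.snd (Prod.snd l))) 1 MvPolynomial.X) : Matrix (Fin 3) (Fin 3) (MvPolynomial σ ℝ)))) ((Matrix.transvection (Prod.fst L1) (Prod.fst (Prod.snd L1)) (MvPolynomial.C (Prod.fst (Prod.snd (Prod.snd L1))) * Option.elim (Prod.snd (Prod.snd (Prod.snd L1))) 1 MvPolynomial.X) : Matrix (Fin 3) (Fin 3) (MvPolynomial σ ℝ))) ((Matrix.transvection (Prod.fst L2) (Prod.fst (Prod.snd L2)) (MvPolynomial.C (Prod.fst (Prod.snd (Prod.snd L2))) * Option.elim (Prod.snd (Prod.snd (Prod.snd L2))) 1 MvPolynomial.X) : Matrix (Fin 3) (Fin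 3) (MvPolynomial σ ℝ)))
    (Matrix.transvection (0 : Fin 3) 2 F) (k2_S_mul_far_mul_S F)
    (fun U hU => by
      obtain ⟨l, hl, rfl⟩ := List.mem_map.1 hU
      exact k2_tame_mul_S_mul l (k2_tame_cases l (hp0 l hl)))
    (fun U hU => by
      obtain ⟨l, hl, rfl⟩ := List.mem_map.1 hU
      exact k2_tame_mul_S_mul l (k2_tame_cases l (hp2 l hl)))
    (by simpa only [List.map_append, List.map_cons, List.prod_append, List.prod_cons] using hF')
  rw [k2_S_T_S, k2_S_T_S] at hid
  have hME : ∀ i j m, ((Matrix.transvection (0 : Fin 3) 2 F) i j).coeff m ≤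
      (((p0.map (fun l => (Matrix.transvection (Prod.fst l) (Prod.fst (Prod.snd l)) (MvPolynomial.C (Prod.fst (Prod.snd (Prod.snd l))) * Option.elim (Prod.snd (Prod.snd (Prod.snd l))) 1 MvPolynomial.X) : Matrix (Fin 3) (Fin 3) (MvPolynomial σ ℝ)))).reverse.prod * Matrix.transvection (0 : Fin 3) 2 F *
        (p2.map (fun l => (Matrix.transvection (Prod.fst l) (Prod.fst (Prod.snd l)) (MvPolynomial.C (Prod.fst (Prod.snd (Prod.snd l))) * Option.elim (Prod.snd (Prod.snd (Prod.snd l))) 1 MvPolynomial.X) : Matrix (Fin 3) (Fin 3) (MvPolynomial σ ℝ)))).reverse.prod) i j).coeff m :=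
    k2_coeff_le_conj _ _ _ (k2_rev_sub_one_nonneg p0 fun l hl => k2_tame_cases l (hp0 l hl))
      (k2_far_nonneg F hpos) (k2_rev_sub_one_nonneg p2 fun l hl => k2_tame_cases l (hp2 l hl))
  have tDa : ∀ (L : Fin 3 × Fin 3 × ℝ × Option σ),
      (if L.1.val + 1 = L.2.1.val ∨ L.2.1.val + 1 = L.1.val then
        -(C L.2.2.1 * L.2.2.2.elim 1 X) else C L.2.2.1 * L.2.2.2.elim 1 X :
          MvPolynomial σ ℝ).totalDegree ≤ 1 := by
    intro L
    split_ifs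
    · rw [MvPolynomial.totalDegree_neg]; exact k2_totalDegree_Cu _ _
    · exact k2_totalDegree_Cu _ _
  obtain ⟨h11, h21⟩ := k2_placement F hpos m₀ hdm hFm₀ q hq' L1.1 L1.2.1 L2.1 L2.2.1
    (hw L1 (by simp)) (hw L2 (by simp)) _ _ (tDa L1) (tDa L2) _ hME hid
  -- the four families
  have three : ∀ i : Fin 3, i = 0 ∨ i = 1 ∨ i = 2 := by decide
  have hv1 : L1.2.1 ≠ 1 := fun h => hw L1 (by simp) (h11.trans h.symm)
  have hv2 : L2.1 ≠ 1 := fun h => hw L2 (by simp) (h.trans h21.symm)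
  rcases three L1.2.1 with hj | hj | hj
  · rcases three L2.1 with hi | hi | hi
    · exact k2_family_I F hdeg hF0 p0 q p2 L1 L2 hw ht ⟨h11, hj⟩ ⟨hi, h21⟩ hF'
    · exact hv2 hi
    · exact k2_family_III F hdeg hF0 p0 q p2 L1 L2 hw ht ⟨h11, hj⟩ ⟨hi, h21⟩ hF'
  · exact hv1 hj
  · rcases three L2.1 with hi | hi | hi
    · exact k2_family_IV F hdeg hF0 p0 q p2 L1 L2 hw ht ⟨h11, hj⟩ ⟨hi, h21⟩ hF'
    · exact hv2 hi
    · exact k2_family_II F hdeg hF0 p0 q p2 L1 L2 hw ht ⟨h11, hj⟩ ⟨hi, h21⟩ hF'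

end Summit.ValiantsHypothesis.ValiantsHypothesis.Cruxes.WordLengthQP.PositiveMonoidExits

end
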